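import Summits.NavierStokesRegularity.NavierStokesRegularity.Theorems.CoriolisHeadLocalEnergyClass
import Summits.NavierStokesRegularity.NavierStokesRegularity.Theorems.CoriolisHeadLocalEnergyDecayOfTopNull
import Summits.NavierStokesRegularity.NavierStokesRegularity.Theorems.CoriolisHeadLocalEnergyDriftNormalFormClosed
import Summits.NavierStokesRegularity.NavierStokesRegularity.Theorems.CoriolisHeadNoCoRotatingCoreReduction
import Summits.NavierStokesRegularity.NavierStokesRegularity.Theorems.CoriolisHeadFarFieldCovarianceFrame
import HarnessLib

/-!
# CoriolisHeadNoCoRotatingCoreOfPineauVicol — crux `NoCoRotatingCore` (stmt-NavierStokesRegularity-22676), line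
# `local_energy_rescue` v2.1 (crux workfile, ns-idea-10 g3; NOT the registered skeleton): the COMPOSITION of the
# line with its four analytic stubs discharged — **`NoCoRotatingCore` ⟸ Pineau–Vicol's Conjecture 1.1 AS PRINTED**

All four analytic stubs of the rescue line are tree theorems: S1 `stub_driftNormalForm` (recentring to a `BMO₂`
pressure; `CoriolisHeadLocalEnergyDriftNormalFormClosed`), S2 `stub_densityBootstrap` (sub-volume density `β = 3/2`;
`CoriolisHeadLocalEnergyDensity`), S3a `stub_localEnergyClass` (linear density + CKN class up to the top;
`CoriolisHeadLocalEnergyClass`), S3b `stub_decayOfTopNull` (Type-I decay from the null top singular set;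
`CoriolisHeadLocalEnergyDecayOfTopNull`).  This file runs the line's composition (the crux workfile's `typeIDecay_of`,
`rotatedProfileLiouville_of`, `NoCoRotatingCore_of`, there kernel-checked modulo `sorry`d stubs) on the landed theorems:

* `typeIDecay_of_localEnergy` — S3: a bounded smooth rotated profile with `BMO₂` pressure and sub-volume density DECAYS
  at the Type-I rate `‖U(y)‖ ≤ K'/(1 + ‖y‖)` (S3a + S3b, unconditional);
* `typeIDecay_of_recentred` — every bounded smooth rotated profile decays at the Type-I rate AFTER RECENTRING by the
  symmetry `U ↦ U(· + y₀) − b` (S1 + S2 + S3, unconditional) — the «bounded ⇒ decaying» step that is FALSE without the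
  recentring (constants), now a theorem with it;
* `rotatedProfileLiouville_of_decayingLiouville` — bounded rotated-profile Liouville from the general-frame DECAYING
  Liouville;
* `noCoRotatingCore_of_pineauVicolConjecture` — **the crux `CoriolisHead.NoCoRotatingCore` BY NAME from Pineau–Vicol's
  Conjecture 1.1 as printed** (profile form, printed frame `(ν, a, B) = (1, ½, αJ)`, `α ≠ 0`, WITH the Type-I decay
  hypothesis; the frame reduction is the landed `decayingRotatedLiouville_of_pineauVicolFrame`).

HONEST FRAMING.  A CONDITIONAL result: the hypothesis is an OPEN conjecture (Pineau–Vicol 2026 Conj. 1.1 = Tsai GSM 192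
Conj. 8.9 = Bradshaw–Tsai OP 5.2; decided in print only at extreme `|α|`, tree fact `pineauVicol2026_rss_liouville`).  The
file REDUCES the crux to the printed conjecture — kernel-checked — and proves nothing about the conjecture itself.
`NoCoRotatingCore`, K1a of line `far_field_constancy`, and NS regularity are NOT proved.

References: B. Pineau, V. Vicol, arXiv:2607.09619, Conj. 1.1, Thm 1.4 [PineauVicol2026]; T.-P. Tsai, ARMA 143 (1998) §4
[Tsai1998]; line card `Cruxes/NoCoRotatingCore/Lines/local_energy_rescue.md`.
-/

noncomputable section

open MeasureTheory Set Function Filter Topology Metric InnerProductSpace Real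
open scoped RealInnerProductSpace Laplacian ContDiff Topology ENNReal NNReal

-- the summit and its single sub-problem share the name (CONVENTIONS §1), as in every Theorems file
set_option linter.dupNamespace false

namespace Summit.NavierStokesRegularity.NavierStokesRegularity.Theorems.CoriolisHead

namespace LocalEnergyRescue

open Literature.Analysis.FluidPDE
open Summit.NavierStokesRegularity.NavierStokesRegularity.Theses

/-- **S3 (Type-I decay from `BMO₂` pressure and sub-volume density), unconditional**: S3a `stub_localEnergyClass` and
S3b `stub_decayOfTopNull` composed as in the crux workfile's `typeIDecay_of`. [cite: Tsai1998, Lemma 4.1 and Cor. 4.3 (pp. 46–47)] -/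
theorem typeIDecay_of_localEnergy :
    ∀ (ν a : ℝ), 0 < ν → 0 < a → ∀ (B : EuclideanSpace ℝ (Fin 3) →L[ℝ] EuclideanSpace ℝ (Fin 3))
      (U : EuclideanSpace ℝ (Fin 3) → EuclideanSpace ℝ (Fin 3)) (P : EuclideanSpace ℝ (Fin 3) → ℝ),
      ContDiff ℝ (⊤ : ℕ∞) U → ContDiff ℝ 2 P → (∀ x, inner ℝ (B x) x = 0) →
      Literature.Analysis.FluidPDE.VectorCalculus.IsDivFree U →
      (∀ y, -(ν • Laplacian.laplacian U y) + a • U y + a • fderiv ℝ U y y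
        + (B (U y) - fderiv ℝ U y (B y)) + Literature.Analysis.FluidPDE.convect U U y
        + gradient P y = 0) →
      (∃ M : ℝ, ∀ y, ‖U y‖ ≤ M) →
      ∀ K : ℝ,
      (∀ (z : EuclideanSpace ℝ (Fin 3)) (ρ : ℝ), 0 < ρ →
        ∃ m : ℝ, ∫ y in Metric.ball z ρ, (P y - m) ^ 2 ≤ K * ρ ^ 3) →
      ∀ (β K₂ : ℝ), 1 < β →
      (∀ (z : EuclideanSpace ℝ (Fin 3)) (ρ : ℝ), 1 ≤ ρ →
        ∫ y in Metric.ball z ρ, ‖U y‖ ^ 2 ≤ K₂ * ρ ^ (3 - β)) →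
      ∃ K' : ℝ, ∀ y, ‖U y‖ ≤ K' / (1 + ‖y‖) := by
  intro ν a hν ha B U P hU hP hB hdiv heq hbdd K hbmo β K₂ hβ hdens
  obtain ⟨-, hcls⟩ := stub_localEnergyClass ν a hν ha B U P hU hP hB hdiv heq hbdd K hbmo β K₂ hβ hdens _
    (fun t x => rfl)
  exact stub_decayOfTopNull ν a hν ha B U P hU hP hB hdiv heq hbdd _ (fun t x => rfl) hcls

/-- **Every bounded smooth rotated profile decays at the Type-I rate after recentring** (S1 + S2 + S3, unconditional):
there are `y₀, b` with `‖U(y + y₀) − b‖ ≤ K'/(1 + ‖y‖)`, and the recentred profile solves the same system with a `BMO₂`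
pressure.  The recentring is necessary: constant profiles are bounded and do not decay.
[cite: Tsai1998, Lemma 4.1 and Cor. 4.3 (pp. 46–47)] -/
theorem typeIDecay_of_recentred :
    ∀ (ν a : ℝ), 0 < ν → 0 < a → ∀ (B : EuclideanSpace ℝ (Fin 3) →L[ℝ] EuclideanSpace ℝ (Fin 3))
      (U : EuclideanSpace ℝ (Fin 3) → EuclideanSpace ℝ (Fin 3)) (P : EuclideanSpace ℝ (Fin 3) → ℝ),
      ContDiff ℝ (⊤ : ℕ∞) U → ContDiff ℝ 2 P → (∀ x, inner ℝ (B x) x = 0) →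
      Literature.Analysis.FluidPDE.VectorCalculus.IsDivFree U →
      (∀ y, -(ν • Laplacian.laplacian U y) + a • U y + a • fderiv ℝ U y y
        + (B (U y) - fderiv ℝ U y (B y)) + Literature.Analysis.FluidPDE.convect U U y
        + gradient P y = 0) →
      (∃ M : ℝ, ∀ y, ‖U y‖ ≤ M) →
      ∃ (y₀ b : EuclideanSpace ℝ (Fin 3)) (P' : EuclideanSpace ℝ (Fin 3) → ℝ) (K' : ℝ),
        ContDiff ℝ (⊤ : ℕ∞) (fun y => U (y + y₀) - b) ∧ ContDiff ℝ 2 P' ∧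
        Literature.Analysis.FluidPDE.VectorCalculus.IsDivFree (fun y => U (y + y₀) - b) ∧
        (∀ y, -(ν • Laplacian.laplacian (fun y => U (y + y₀) - b) y) + a • (fun y => U (y + y₀) - b) y
          + a • fderiv ℝ (fun y => U (y + y₀) - b) y y
          + (B ((fun y => U (y + y₀) - b) y) - fderiv ℝ (fun y => U (y + y₀) - b) y (B y))
          + Literature.Analysis.FluidPDE.convect (fun y => U (y + y₀) - b) (fun y => U (y + y₀) - b) y
          + gradient P' y = 0) ∧
        (∀ y, ‖U (y + y₀) - b‖ ≤ K' / (1 + ‖y‖)) := by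
  intro ν a hν ha B U P hU hP hB hdiv heq hbdd
  obtain ⟨y₀, b, P', K, hV, hP', hdivV, heqV, hbddV, hBMO⟩ := stub_driftNormalForm ν a hν ha B U P hU hP hB hdiv heq hbdd
  obtain ⟨β, K₂, hβ, hdens⟩ := stub_densityBootstrap ν a hν ha B (fun y => U (y + y₀) - b) P' hV hP' hB hdivV heqV hbddV K hBMO
  obtain ⟨K', hdec⟩ := typeIDecay_of_localEnergy ν a hν ha B (fun y => U (y + y₀) - b) P' hV hP' hB hdivV heqV hbddV K
    hBMO β K₂ hβ hdens
  exact ⟨y₀, b, P', K', hV, hP', hdivV, heqV, hdec⟩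

/-- **Bounded rotated-profile Liouville from the general-frame decaying Liouville** (the crux workfile's
`rotatedProfileLiouville_of` with S1, S2, S3 discharged): if decaying smooth rotated profiles vanish (any `ν, a > 0`, any
skew `B`), then bounded smooth rotated profiles are constant. [cite: PineauVicol2026, Conj. 1.1 (arXiv:2607.09619 p. 3)] -/
theorem rotatedProfileLiouville_of_decayingLiouville
    (hR : ∀ (ν a : ℝ), 0 < ν → 0 < a → ∀ (B : EuclideanSpace ℝ (Fin 3) →L[ℝ] EuclideanSpace ℝ (Fin 3))
        (U : EuclideanSpace ℝ (Fin 3) → EuclideanSpace ℝ (Fin 3)) (P : EuclideanSpace ℝ (Fin 3) → ℝ),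
        ContDiff ℝ (⊤ : ℕ∞) U → ContDiff ℝ 2 P → (∀ x, inner ℝ (B x) x = 0) →
        Literature.Analysis.FluidPDE.VectorCalculus.IsDivFree U →
        (∀ y, -(ν • Laplacian.laplacian U y) + a • U y + a • fderiv ℝ U y y
          + (B (U y) - fderiv ℝ U y (B y)) + Literature.Analysis.FluidPDE.convect U U y
          + gradient P y = 0) →
        (∃ K : ℝ, ∀ y, ‖U y‖ ≤ K / (1 + ‖y‖)) →
        ∀ y, U y = 0) :
    ∀ (ν a : ℝ), 0 < ν → 0 < a → ∀ (B : EuclideanSpace ℝ (Fin 3) →L[ℝ] EuclideanSpace ℝ (Fin 3))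
      (U : EuclideanSpace ℝ (Fin 3) → EuclideanSpace ℝ (Fin 3)) (P : EuclideanSpace ℝ (Fin 3) → ℝ),
      ContDiff ℝ (⊤ : ℕ∞) U → ContDiff ℝ 2 P → (∀ x, inner ℝ (B x) x = 0) →
      Literature.Analysis.FluidPDE.VectorCalculus.IsDivFree U →
      (∀ y, -(ν • Laplacian.laplacian U y) + a • U y + a • fderiv ℝ U y y
        + (B (U y) - fderiv ℝ U y (B y)) + Literature.Analysis.FluidPDE.convect U U y
        + gradient P y = 0) →
      (∃ M : ℝ, ∀ y, ‖U y‖ ≤ M) → ∃ b : EuclideanSpace ℝ (Fin 3), ∀ y, U y = b := by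
  intro ν a hν ha B U P hU hP hB hdiv heq hbdd
  obtain ⟨y₀, b, P', K', hV, hP', hdivV, heqV, hdec⟩ := typeIDecay_of_recentred ν a hν ha B U P hU hP hB hdiv heq hbdd
  have hzero : ∀ y, (fun y => U (y + y₀) - b) y = 0 :=
    hR ν a hν ha B (fun y => U (y + y₀) - b) P' hV hP' hB hdivV heqV ⟨K', hdec⟩
  refine ⟨b, fun y => ?_⟩
  have h := hzero (y - y₀)
  simp only [sub_add_cancel] at h
  exact sub_eq_zero.mp h

end LocalEnergyRescue

open LocalEnergyRescue Literature.Analysis.FluidPDE Summit.NavierStokesRegularity.NavierStokesRegularity.Theses in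
/-- **The crux `CoriolisHead.NoCoRotatingCore` from Pineau–Vicol's Conjecture 1.1 AS PRINTED** (profile form, printed
frame `(ν, a, B) = (1, ½, αJ)`, `α ≠ 0`, `J = rotGen`, WITH the Type-I decay hypothesis `‖U(y)‖ ≤ K/(1+‖y‖)`): the line
`local_energy_rescue` composed on its four landed analytic stubs (S1 p639741, S2 p633214, S3a, S3b p629470), the landed
frame reduction `decayingRotatedLiouville_of_pineauVicolFrame` (p605289) and the landed equivalence
`noCoRotatingCore_iff_rotatedProfileLiouville`.  CONDITIONAL: the hypothesis is an OPEN conjecture (decided in print only at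
extreme `|α|`, PineauVicol2026 Thm 1.4); this theorem reduces the crux to it and claims nothing about the conjecture,
`NoCoRotatingCore` itself, or NS regularity. [cite: PineauVicol2026, Conj. 1.1 and Thm 1.4 (arXiv:2607.09619 pp. 3–4)] -/
theorem noCoRotatingCore_of_pineauVicolConjecture
    (hPV : ∀ α : ℝ, α ≠ 0 →
      ∀ (U : EuclideanSpace ℝ (Fin 3) → EuclideanSpace ℝ (Fin 3)) (P : EuclideanSpace ℝ (Fin 3) → ℝ),
      ContDiff ℝ (⊤ : ℕ∞) U → ContDiff ℝ 2 P →
      Literature.Analysis.FluidPDE.VectorCalculus.IsDivFree U →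
      (∀ y, α • (rotGen (U y) - fderiv ℝ U y (rotGen y)) + (1 / 2 : ℝ) • U y
        + (1 / 2 : ℝ) • fderiv ℝ U y y - Laplacian.laplacian U y
        + Literature.Analysis.FluidPDE.convect U U y + gradient P y = 0) →
      (∃ K : ℝ, ∀ y, ‖U y‖ ≤ K / (1 + ‖y‖)) →
      ∀ y, U y = 0) :
    CoriolisHead.NoCoRotatingCore :=
  noCoRotatingCore_iff_rotatedProfileLiouville.mpr
    (rotatedProfileLiouville_of_decayingLiouville (decayingRotatedLiouville_of_pineauVicolFrame hPV))

end Summit.NavierStokesRegularity.NavierStokesRegularity.Theorems.CoriolisHead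

end
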